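import Mathlib
import Literature.Computability.Cryptography.QubitRegister
import Literature.Computability.QuantumComplexity.PauliExpansion
import HarnessLib

/-!
# Barrier catalogue `QuantumAdvantage` — entanglement you cannot rotate away: a flat Pauli spectrum forces a low-purity linear cut in EVERY Clifford frame

Topic `Literature/Barriers/QuantumAdvantage` (D-0021). Summit statement:
`QuantumAdvantage := ∃ L, L ∈ BQP ∧ L ∉ BPP`.

One of six entries that file the PROVED bounds of the retired route `SymplecticPurity`
(`Summits/QuantumAdvantage/QuantumAdvantage/Theses/SymplecticPurity.lean`, closed `retired` on the
human ruling of 2026-08-16 "file the proven bounds as barriers, let the open pair go") as barrier items: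
`NoFreeFramePurityBound` (this file, fact `symplecticPurityBound`), `NoFreeFrameGaussianBound`
(`gaussianDegreeBound`), `NoFreeFrameSBoxSpectrum` (`graphStateSpectrum`), `NoFreeFrameCubeAlmostBent`
(`cubeAlmostBent`), `NoFreeFrameCubeGraphFlat` (`cubeGraphFlat`) and `NoFreeFrame` (`noFreeFrame`, the
complexity-level kill of the free-frame road). The six files are independent (no mutual imports).

BARRIER: technique_class := classical simulation / dequantisation of quantum computations through a
  FREE CLIFFORD FRAME composed with a low-bond-dimension tensor network — every state of the
  computation is written `U · φ` with `U` a Clifford unitary (any qubit ordering and any number of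
  adjoined stabilizer ancillas `|0…0⟩`, since wire permutations and stabilizer preparations are
  Clifford) and `φ` a matrix-product state of polynomial bond dimension across the linear cuts, the
  representability beneath Clifford-augmented MPS / DMRG / TDVP ("CAMPS")
  [cite: QianHuangQin2024] [cite: QianHuangQin2024TDVP] [cite: LiuClark2024, §2 (OFD/OBD disentangling; CAMPS for t ≤ N doped circuits)],
  Clifford disentangling of doped Clifford circuits [cite: FuxEtAl2024, Thm. 1 and Fig. 1 (t ≲ N − 1.607)]
  and Clifford "entanglement cooling" of tensor networks [cite: MasotllimaEtAl2026, §I and Thm. III.1];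
  bond dimension `poly(n)` along a pure-state computation is Vidal's sufficient condition for
  efficient classical simulation [cite: Vidal2003, Thm. 1];
  blocks := any such representation of an `ε`-FLAT state `ψ` (`|⟨ψ|σ_S|ψ⟩| ≤ ε` for every Pauli
  string `S ≠ I`): for every `m` and every Clifford unitary `U` on `n + m` qubits the state
  `U (ψ ⊗ |0^m⟩)` has a LINEAR cut `{wires < k}` of purity `Tr ρ² ≤ 4ε` (`symplecticPurityBound`),
  i.e. Schmidt rank `≥ 1/(4ε)` and Rényi-2 entanglement `≥ log₂(1/ε) − 2` at some bond, in every
  qubit ordering and for every stabilizer ancilla state; for the explicit `2^{1−n/2}`-flat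
  data-loading states of almost-bent S-boxes (`cubeGraphFlat`, file `NoFreeFrameCubeGraphFlat`) the
  bond dimension is `≥ 2^{n/2−3}` in every Clifford frame, and on a uniform Clifford+T family loading
  that state the free-frame road to `BQP ⊆ BPP` is refuted outright (`noFreeFrame`, file `NoFreeFrame`);
  because := purity of a cut is Pauli-spectral mass on the cut, `Tr ρ_A² = 2^{−|A|} Σ_{Q ∈ 𝒫_A} ⟨Q⟩²`
  (Parseval in the Pauli basis) [folklore]; conjugation by a Clifford unitary permutes the Pauli
  strings up to unit phases — a symplectic map of `𝔽₂^{2(n+m)}` [cite: AaronsonGottesman2004, §III (tableau representation of the Clifford action)];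
  the strings with non-zero expectation on `ψ ⊗ |0^m⟩` are (data string) `⊗ {I,Z}^m`, and the
  stabilizer group `𝒮 = U (I ⊗ ⟨Z_j⟩) U†` of the rotated ancillas meets `𝒫_A` in the local subgroup
  `𝒮_A` of the stabilizer entanglement count [cite: FattalEtAl2004, Thm. 1 and the formula E = ½|S_AB| (p = n_A − |S_A|)];
  counting fibres gives `Tr ρ_{A_k}² ≤ a_k/2^k + ε²·2^k/a_k` with `a_k = |𝒮_{A_k}|` non-decreasing
  from `a_0 = 1` to `a_{n+m} = 2^m` along the chain of linear cuts, and at the FIRST passage of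
  `a_k/2^k` below `2ε` the two terms sum to `≤ 3ε` (the degenerate ranges `ε ≥ 1/4` and
  `2ε < 2^{−n}` are direct) — the planner's ancilla-robust first-passage argument, machine-checked in
  this tree (see `status`); the cut-by-cut claim WITHOUT the first-passage choice is false with clean
  ancillas, which is why only SOME linear cut is asserted;
  evasions_known := (a) NON-free frames — `U` containing non-Clifford gates, magic-state injection,
  state-dependent non-Clifford disentanglers: nothing is claimed; (b) COMPOSITE free frames
  Clifford ∘ fermionic-Gaussian ∘ Clifford (Clifford-and-matchgate augmented DMRG [cite: HuangEtAl2025])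
  — UNDECIDED: this was the retired route's open crux `CompositeFrameBound`
  (stmt-QuantumAdvantage-10730; the pure Gaussian and the pure Clifford layers are covered separately
  by `gaussianDegreeBound` and this entry, but flatness is an `ℓ∞` condition in ONE basis and the two
  bounds do not iterate); (c) states that are NOT flat — stabilizer-like states of stabilizer nullity
  `ν` ARE Clifford-compressible onto `ν` qubits (nullity distillation), so their frame-minimised
  entanglement is `≤ ν` [cite: GuOlivieroLeone2024, §II.A (Thm. 1, Algorithm 1, ν-compressible states)];
  whether the data states of Shor-type arithmetic (`|x⟩|g^x mod p⟩`) are flat is the retired route's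
  other open crux `DlogGraphFlat` (stmt-QuantumAdvantage-10732, undecided; refuter evidence on that
  item exhibits structured resonances at Mersenne-type moduli); (d) the ORBIT-AVERAGED flatness law —
  stabilizer linear entropy ∝ entanglement-spectrum flatness averaged over the Clifford orbit
  [cite: TirritoEtAl2023, Theorem (main text) and SM §1.1] — is an identity in expectation, consistent
  with and not implying this minimum-over-the-orbit bound; (e) approximate representations: the bound
  is for the exact state; the routine `ε`-robust version (`|Tr ρ² − Tr σ²| ≤ 2‖ρ − σ‖₁`) and the
  operator/Heisenberg version for pipelines that never materialise the state are NOT vendored;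
  scope_caveats := (i) only LINEAR cuts `{wires < k}` of the given wire order are named, but every
  ordering is covered because permutation matrices are Clifford and are absorbed in `U`; (ii) the
  data register comes first and the ancillas are `|0^m⟩` (`tensorVec ψ (zeroState m)`); other
  stabilizer ancilla states and any Clifford pre-processing are absorbed in `U`; (iii) "Clifford" is
  SEMANTIC — `U` unitary with `U σ_S U† = c · σ_{S'}`, `‖c‖ = 1`, for every Pauli string `S`; this
  contains every `T`-free Clifford+T circuit and does not wait for a generation theorem of the tree's
  gate set; (iv) purity is written as the four-fold agreement sum
  `Σ_{x₁ x₂ x₃ x₄} [x₁ =_Ā x₂, x₂ =_A x₃, x₃ =_Ā x₄, x₄ =_A x₁] φ(x₁) φ̄(x₂) φ(x₃) φ̄(x₄)` (`= Tr ρ_A²`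
  for a unit vector `φ`) under `‖·‖`; (v) `n ≥ 1`; the constant `4` is not optimised (`3` is what the
  proof gives); (vi) nothing is said about sampling-type simulators that are not frame-plus-MPS
  representations (stabilizer-rank and Pauli-propagation methods have their own entries/routes);
  status := theorem — MACHINE-CHECKED IN THIS TREE, Summits side:
  `Summit.QuantumAdvantage.QuantumAdvantage.Theorems.SymplecticPurity.SymplecticPurityBound_proof`
  (files `Summits/QuantumAdvantage/QuantumAdvantage/Theorems/SymplecticPuritySymplecticPurityBound.lean`
  and `…SymplecticPurityBound{Pauli,Kernel,Tensor,Counting}.lean`, ≈ 1 300 lines, standard axioms)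
  closed item stmt-QuantumAdvantage-10729 of route `SymplecticPurity`; it is typed below as a NAMED
  FACT only because `Literature` may not import `Summits` (CONVENTIONS §2): the body is, token for
  token, the route decl `Summit.QuantumAdvantage.QuantumAdvantage.Theses.SymplecticPurity.SymplecticPurityBound`
  (definitionally equal — `Iff.rfl` — and discharged by `exact SymplecticPurityBound_proof` in the
  filing planner's scratch check, 2026-08-16), so the discharge of record is the ONE-LINE Summits-side
  `theorem symplecticPurityBound_holds : Literature.Barriers.QuantumAdvantage.symplecticPurityBound :=
  Summit.QuantumAdvantage.QuantumAdvantage.Theorems.SymplecticPurity.SymplecticPurityBound_proof` —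
  do NOT re-prove it in `Literature`. Not located in print as stated (route novelty audit 2026-08-15:
  new-combination; nearest: [cite: TirritoEtAl2023, Theorem (main text)] orbit average,
  [cite: FattalEtAl2004, Thm. 1] stabilizer states, [cite: GuOlivieroLeone2024, §II.A] the matching upper bound).

## Contents

* `symplecticPurityBound` — THE BARRIER FACT of this file (the only declaration): an `ε`-flat unit
  vector on `n ≥ 1` qubits, padded with `|0^m⟩` and rotated by any semantic Clifford unitary on
  `n + m` qubits, has a linear cut of purity `≤ 4ε`.

## Design notes

* One named fact, no other declaration (D-0026 / `lint.fact-fanout`: a barrier proposal carries the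
  one barrier fact). Purity, flatness and "Clifford unitary" are written inline over the tree's
  `QReg`, `normSq`, `tensorVec`, `zeroState` (`Literature/Computability/Cryptography/QubitRegister.lean`)
  and `Pauli`, `pauliString` (`Literature/Computability/QuantumComplexity/PauliExpansion.lean`),
  exactly as on the route, so that the tree theorem discharges the fact by `exact`.
* `open scoped Classical` matches the route file's elaboration context (decidability of the `if`).
* Why vendor a Summits theorem here at all: the barrier catalogue is what `route open` / `idea add`
  must address (CONVENTIONS §7); the kill of the free-frame road is negative knowledge every future
  dequantisation line on this summit has to evade, and the route that produced it is retired.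

## References

* [FattalEtAl2004] D. Fattal, T. Cubitt, Y. Yamamoto, S. Bravyi, I. Chuang, *Entanglement in the
  stabilizer formalism*, arXiv:quant-ph/0406168: Thm. 1, `E = ½|S_AB|`. Read via `lit read`.
* [AaronsonGottesman2004] S. Aaronson, D. Gottesman, *Improved simulation of stabilizer circuits*,
  Phys. Rev. A 70, 052328: §III.
* [TirritoEtAl2023] E. Tirrito et al., *Quantifying nonstabilizerness through entanglement spectrum
  flatness*, Phys. Rev. A 109, L040401 (arXiv:2304.01175): Theorem (main text), SM §1.1. Read.
* [GuOlivieroLeone2024] A. Gu, S. Oliviero, L. Leone, *Magic-induced computational separation in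
  entanglement theory*, PRX Quantum 6, 020324 (arXiv:2403.19610): §II.A. Read.
* [LiuClark2024] Z. Liu, B. Clark, *Classical simulability of Clifford+T circuits with
  Clifford-augmented matrix product states*, arXiv:2412.17209: §2. Read.
* [FuxEtAl2024] G. Fux, B. Béri, R. Fazio, E. Tirrito, *Disentangling magic states with classically
  simulable quantum circuits*, PRL 135, 260605 (arXiv:2410.09001): Thm. 1. Read.
* [MasotllimaEtAl2026] S. Masot-Llima et al., *Limits of Clifford disentangling in tensor network
  states*, arXiv:2602.15942: Thm. III.1. Read.
* [QianHuangQin2024] / [QianHuangQin2024TDVP] / [HuangEtAl2025] — the CAMPS corpus (PRL 133, 190402;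
  arXiv:2407.03202; arXiv:2505.08635). [Vidal2003] G. Vidal, PRL 91, 147902: Thm. 1. Read.
-/

namespace Literature.Barriers.QuantumAdvantage

open scoped BigOperators Matrix ComplexConjugate Classical
open Literature.Computability.Cryptography Literature.Computability.QuantumComplexity

/-- **Entanglement you cannot rotate away (flat spectrum ⇒ low-purity cut in every Clifford frame).**
Let `ψ` be a unit vector on `n ≥ 1` qubits with `|⟨ψ|σ_S|ψ⟩| ≤ ε` for every Pauli string `S ≠ I`.
For every `m` and every unitary `U` on `n + m` qubits that normalises the Pauli group up to unit
phases (`U σ_S U† = c σ_{S'}`, `‖c‖ = 1` — a semantic Clifford unitary), the state `U (ψ ⊗ |0^m⟩)`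
has a linear cut `{wires < k}`, `k ≤ n + m`, whose purity (four-fold agreement sum) is `≤ 4ε`;
hence Schmidt rank `≥ 1/(4ε)` at that bond, in every qubit ordering and with any stabilizer ancillas.
- technique_class: free CLIFFORD frame + low-bond tensor network (CAMPS / Clifford-DMRG / Clifford-TDVP
  / stabilizer tensor networks / Clifford disentangling and entanglement cooling), any ordering, any
  number of stabilizer ancillas
- blocks: representing an `ε`-flat state with bond dimension `< 1/(4ε)` on all linear cuts in some
  Clifford frame; for `2^{−δn}`-flat explicit families (almost-bent S-box data states,
  `cubeGraphFlat`) every Clifford frame has a bond of dimension `≥ 2^{δn}/4`, which kills the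
  free-frame road to `BQP ⊆ BPP` (`noFreeFrame`)
- because: `Tr ρ_A² = 2^{−|A|} Σ_{Q∈𝒫_A}⟨Q⟩²`; Clifford conjugation permutes Pauli strings up to
  phase [cite: AaronsonGottesman2004, §III]; stabilizer cleaning count `|𝒫_A ∩ 𝒮^⊥|` via the local
  subgroup `𝒮_A` [cite: FattalEtAl2004, Thm. 1]; first passage of `|𝒮_{A_k}|/2^k` through `(ε, 2ε]`
- evasions_known: non-Clifford frames; composite Clifford∘Gaussian∘Clifford frames
  [cite: HuangEtAl2025] (undecided, ex-crux `CompositeFrameBound` stmt-QuantumAdvantage-10730);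
  non-flat states (nullity-`ν` states are `ν`-compressible [cite: GuOlivieroLeone2024, §II.A]);
  the orbit-averaged law [cite: TirritoEtAl2023, Theorem (main text)] is consistent and weaker
- scope_caveats: exact states only (no `ε`-robust / operator version vendored); linear cuts of the
  given order (all orders via permutation ∈ Clifford); constant `4` unoptimised; `n ≥ 1`
- status: theorem, machine-checked in this tree as
  `Summit.QuantumAdvantage.QuantumAdvantage.Theorems.SymplecticPurity.SymplecticPurityBound_proof`
  (item stmt-QuantumAdvantage-10729, route `SymplecticPurity`, retired 2026-08-16); named fact here
  only because `Literature` does not import `Summits` — body definitionally equal to the route decl,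
  discharge = the one-line Summits-side `symplecticPurityBound_holds := …SymplecticPurityBound_proof`
[folklore] -/
def symplecticPurityBound : Prop :=
  ∀ (n m : ℕ) (ε : ℝ) (ψ : QReg n → ℂ), 1 ≤ n → normSq ψ = 1 →
    (∀ S : Fin n → Pauli, S ≠ (fun _ => Pauli.I) → ‖star ψ ⬝ᵥ (pauliString S).mulVec ψ‖ ≤ ε) →
    ∀ U : Matrix (QReg (n + m)) (QReg (n + m)) ℂ, U ∈ Matrix.unitaryGroup (QReg (n + m)) ℂ →
      (∀ S : Fin (n + m) → Pauli, ∃ S' : Fin (n + m) → Pauli, ∃ c : ℂ,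
        ‖c‖ = 1 ∧ U * pauliString S * star U = c • pauliString S') →
      ∃ k ≤ n + m,
        ‖∑ x₁ : QReg (n + m), ∑ x₂ : QReg (n + m), ∑ x₃ : QReg (n + m), ∑ x₄ : QReg (n + m),
          (if (∀ i, k ≤ i.val → x₁ i = x₂ i) ∧ (∀ i, i.val < k → x₂ i = x₃ i) ∧
              (∀ i, k ≤ i.val → x₃ i = x₄ i) ∧ (∀ i, i.val < k → x₄ i = x₁ i) then
            (U.mulVec (tensorVec ψ (zeroState m))) x₁ * star ((U.mulVec (tensorVec ψ (zeroState m))) x₂) *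
              (U.mulVec (tensorVec ψ (zeroState m))) x₃ * star ((U.mulVec (tensorVec ψ (zeroState m))) x₄)
          else 0)‖ ≤ 4 * ε

end Literature.Barriers.QuantumAdvantage
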